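import Summits.ResolutionOfSingularities.ResolutionOfSingularities.Theses.AbhyankarShadows
import Summits.ResolutionOfSingularities.ResolutionOfSingularities.Theses.Descent
import Summits.ResolutionOfSingularities.ResolutionOfSingularities.Theorems.RisoStrataDescentAlgclosedToPerfectGaloisInvariant
import Summits.ResolutionOfSingularities.ResolutionOfSingularities.Theorems.AbhyankarShadowsDescentAlgclosedToPerfectInvariantIdealOfStableRegularBlowup
import Literature.AlgebraicGeometry.Motives.GeometricallyReducedPerfectField
import Literature.AlgebraicGeometry.Resolution.BlowupsLocal

/-!
# `DescentAlgclosedToPerfect` (stmt-ResolutionOfSingularities-0550): a Galois-STABLE regular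
# blow-up at a finite Galois level suffices

Route `ResolutionOfSingularities/AbhyankarShadows` (the crux is shared `rfl`-equally with the routes
Descent / RisoStrata / UniformComplexity / EquisingularLift / TropicalLinks / TeissierJung /
AnalyticWildDescent). Line `npc-fixed-vertex` (`Cruxes/DescentAlgclosedToPerfect/Lines/npc_fixed_vertex.lean`,
crux idea `Ideas/npc-fixed-vertex.md`): the composition of the line with its first stub discharged
(`Theorems.stub_invariantIdeal_of_stableRegularBlowup`, p172404), as a sorry-free REDUCTION of the
crux to the line's one open stub `stub_fixedVertexPrinciple`.

* `StableRegularBlowupPrinciple p` is NOT introduced as a definition: the hypothesis is spelled out.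
* `descentAlgclosedToPerfect_of_stableRegularBlowup` — if, for every prime `p` at which resolution
  holds over all algebraically closed fields of characteristic `p`, every integral separated scheme
  `X` of finite type over a perfect field `k` of characteristic `p` admits, at some finite Galois
  level `L/k`, a REGULAR blow-up `ρ : Y → X_L = X ×_k Spec L` along a non-zero ideal sheaf `I` which
  is ALSO a blow-up along every Galois conjugate `(gal σ)⁻¹ I · 𝒪` (a Galois-fixed vertex of the
  poset of regular projective models of `X_L` over `X_L`), then `DescentAlgclosedToPerfect` holds.
  Proof: the norm ideal `∏_σ (gal σ)⁻¹ I` is a non-zero Galois-INVARIANT centre of the same blow-up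
  (`Theorems.stub_invariantIdeal_of_stableRegularBlowup`, Stacks 080A), and invariant resolving
  ideals descend (`Theorems.descentAlgclosedToPerfect_of_galoisInvariantResolvingIdeal`, p150140:
  Speiser descent of the ideal sheaf, flat descent of the blow-up and of regularity).
* `descentAlgclosedToPerfect_descent_of_stableRegularBlowup` — the same for the item's canonical
  copy `Theses.Descent.DescentAlgclosedToPerfect`.
* `stableRegularBlowup_of_perfectResBlowup` — UPPER BRACKET: the open stub's conclusion follows
  (without the antecedent) from resolution over perfect fields IN BLOW-UP FORM, at the level
  `L = k`; so the stub sits between the blow-up forms of the consequent and of the crux — it is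
  crux-sized, and as irrefutable in practice as the crux.
* `descentAlgclosedToPerfect_of_autInvariantResolvingIdealAlgClosed` — the RESTATED ANTECEDENT the
  previous leads recommended (crux `NOTES.md` §2 γ1), made formal: if over every algebraically closed
  field `K` of characteristic `p` every reduced separated `V` of finite type carries a non-zero ideal
  sheaf with regular blow-up that is invariant under ALL scheme automorphisms of `V` (what every
  isomorphism-functorial resolution algorithm provides, Kollár 2007, 3.34.1–3.34.2), then the crux
  holds — the Galois automorphisms `gal σ` of `X ×_k Spec k̄` are scheme automorphisms, so such an
  ideal is `Aut(k̄/k)`-invariant and `Theorems.descentAlgclosedToPerfect_of_autInvariantResolvingIdeal`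
  (p150140) applies. No finite level, no choice of `L`.

Compared with the seed reduction (invariant resolving ideal, β'), stability is the form a
fixed-point argument on regular models delivers: `Y ≅ (gal σ)^* Y` over `X_L` for all `σ` says
exactly that `ρ` is a blow-up along every conjugate centre (`IsBlowup` is a universal property, so
it is transported along `X_L`-isomorphisms of the source).
-/

noncomputable section

set_option linter.dupNamespace false -- mandated namespace of this single-conjunct summit

open CategoryTheory CategoryTheory.Limits AlgebraicGeometry
open Literature.AlgebraicGeometry.Resolution Literature.AlgebraicGeometry.Motives
open Literature.AlgebraicGeometry.Motives.AbelianVariety (bcSpec)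

namespace Summit.ResolutionOfSingularities.ResolutionOfSingularities.Theorems

/-- **Crux `DescentAlgclosedToPerfect` from Galois-STABLE regular blow-ups at a finite Galois
level.** Suppose that for every prime `p` for which resolution holds over all algebraically closed
fields of characteristic `p`, every integral separated scheme `X` of finite type over a perfect
field `k` of characteristic `p` has a finite Galois extension `L/k`, a non-zero ideal sheaf `I` on
`X_L = X ×_k Spec L` and a regular blow-up `ρ : Y ⟶ X_L` along `I` which is also a blow-up along
every conjugate `(gal σ)⁻¹ I · 𝒪`, `σ ∈ Gal(L/k)`. Then `DescentAlgclosedToPerfect` holds (route copy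
`AbhyankarShadows`). [cite: Kollar2007, 3.34.2 p. 131 and Thm. 3.36; StacksProject, Tag 080A] -/
theorem descentAlgclosedToPerfect_of_stableRegularBlowup
    (H : ∀ p : ℕ, p.Prime →
      (∀ (k : Type) [Field k] [CharP k p] [IsAlgClosed k] (X : Scheme.{0})
        (f : X ⟶ Spec (.of k)), IsSeparated f → LocallyOfFiniteType f → QuasiCompact f →
        IsReduced X → Scheme.HasResolution X) →
      ∀ (k : Type) [Field k] [CharP k p] [PerfectField k] (X : Scheme.{0}) (f : X ⟶ Spec (.of k)),
        IsSeparated f → LocallyOfFiniteType f → QuasiCompact f → IsIntegral X →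
        ∃ (L : Type) (_ : Field L) (_ : Algebra k L) (_ : FiniteDimensional k L) (_ : IsGalois k L)
          (I : (GaloisDescent.bc L (Over.mk f)).IdealSheafData) (Y : Scheme.{0})
          (ρ : Y ⟶ GaloisDescent.bc L (Over.mk f)),
          I ≠ ⊥ ∧ IsBlowup ρ I ∧ Scheme.IsRegular Y ∧
            ∀ σ : L ≃ₐ[k] L, IsBlowup ρ (I.comap (GaloisDescent.gal L (Over.mk f) σ))) :
    Summit.ResolutionOfSingularities.ResolutionOfSingularities.Theses.AbhyankarShadows.DescentAlgclosedToPerfect := by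
  refine descentAlgclosedToPerfect_of_galoisInvariantResolvingIdeal ?_
  intro p hp hA k _ _ _ X f hs hl hq hi
  obtain ⟨L, _, _, _, _, I, Y, ρ, hI0, hρ, hY, hst⟩ := H p hp hA k X f hs hl hq hi
  haveI := hl
  haveI hXN : IsLocallyNoetherian X := LocallyOfFiniteType.isLocallyNoetherian f
  haveI : IsLocallyNoetherian (Over.mk f : SchemeOver k).left := hXN
  haveI : IsReduced (Over.mk f : SchemeOver k).left := (inferInstance : IsReduced X)
  haveI : GeometricallyReduced (bcSpec k L) := geometricallyReduced_bcSpec_of_isSeparable k L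
  haveI : IsReduced (GaloisDescent.bc L (Over.mk f)) := inferInstance
  obtain ⟨J, hJ0, hJ, hρJ⟩ := stub_invariantIdeal_of_stableRegularBlowup L (Over.mk f) hI0 hρ hst
  exact ⟨L, _, _, inferInstance, inferInstance, J, Y, ρ, hJ0, hJ, hρJ, hY⟩

/-- The same reduction for the item's canonical copy `Theses.Descent.DescentAlgclosedToPerfect`
(`rfl`-equal to the AbhyankarShadows copy). [cite: Kollar2007, Thm. 3.36] -/
theorem descentAlgclosedToPerfect_descent_of_stableRegularBlowup
    (H : ∀ p : ℕ, p.Prime →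
      (∀ (k : Type) [Field k] [CharP k p] [IsAlgClosed k] (X : Scheme.{0})
        (f : X ⟶ Spec (.of k)), IsSeparated f → LocallyOfFiniteType f → QuasiCompact f →
        IsReduced X → Scheme.HasResolution X) →
      ∀ (k : Type) [Field k] [CharP k p] [PerfectField k] (X : Scheme.{0}) (f : X ⟶ Spec (.of k)),
        IsSeparated f → LocallyOfFiniteType f → QuasiCompact f → IsIntegral X →
        ∃ (L : Type) (_ : Field L) (_ : Algebra k L) (_ : FiniteDimensional k L) (_ : IsGalois k L)
          (I : (GaloisDescent.bc L (Over.mk f)).IdealSheafData) (Y : Scheme.{0})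
          (ρ : Y ⟶ GaloisDescent.bc L (Over.mk f)),
          I ≠ ⊥ ∧ IsBlowup ρ I ∧ Scheme.IsRegular Y ∧
            ∀ σ : L ≃ₐ[k] L, IsBlowup ρ (I.comap (GaloisDescent.gal L (Over.mk f) σ))) :
    Summit.ResolutionOfSingularities.ResolutionOfSingularities.Theses.Descent.DescentAlgclosedToPerfect :=
  descentAlgclosedToPerfect_of_stableRegularBlowup H

/-- **Upper bracket: the open stub is implied by resolution over perfect fields in BLOW-UP form.**
If every integral separated scheme of finite type over a perfect field of characteristic `p` has a
regular blow-up along a non-zero ideal sheaf, then (with no use of the antecedent) every such `X/k`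
has a Galois-stable regular blow-up at the finite Galois level `L = k` (the Galois group of `k/k`
is trivial). Together with `descentAlgclosedToPerfect_of_stableRegularBlowup` this brackets the
line's open stub between the blow-up forms of the consequent and of the crux.
[cite: Kollar2007, Thm. 3.36] -/
theorem stableRegularBlowup_of_perfectResBlowup {p : ℕ}
    (H : ∀ (k : Type) [Field k] [CharP k p] [PerfectField k] (X : Scheme.{0}) (f : X ⟶ Spec (.of k)),
      IsSeparated f → LocallyOfFiniteType f → QuasiCompact f → IsIntegral X →
      ∃ (I : X.IdealSheafData) (Y : Scheme.{0}) (ρ : Y ⟶ X),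
        I ≠ ⊥ ∧ IsBlowup ρ I ∧ Scheme.IsRegular Y)
    (k : Type) [Field k] [CharP k p] [PerfectField k] (X : Scheme.{0}) (f : X ⟶ Spec (.of k))
    (hs : IsSeparated f) (hl : LocallyOfFiniteType f) (hq : QuasiCompact f) (hi : IsIntegral X) :
    ∃ (L : Type) (_ : Field L) (_ : Algebra k L) (_ : FiniteDimensional k L) (_ : IsGalois k L)
      (I : (GaloisDescent.bc L (Over.mk f)).IdealSheafData) (Y : Scheme.{0})
      (ρ : Y ⟶ GaloisDescent.bc L (Over.mk f)),
      I ≠ ⊥ ∧ IsBlowup ρ I ∧ Scheme.IsRegular Y ∧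
        ∀ σ : L ≃ₐ[k] L, IsBlowup ρ (I.comap (GaloisDescent.gal L (Over.mk f) σ)) := by
  obtain ⟨I, Y, ρ, hI0, hρ, hY⟩ := H k X f hs hl hq hi
  -- `X ×_k Spec k ≅ X` via the first projection (`Spec k → Spec k` is the identity)
  have hbc : bcSpec k k = 𝟙 _ := by
    change Spec.map (CommRingCat.ofHom (algebraMap k k)) = 𝟙 _
    rw [Algebra.algebraMap_self]
    exact Spec.map_id _
  haveI : IsIso (bcSpec k k) := hbc ▸ inferInstance
  haveI : IsIso (pullback.fst (Over.mk f : SchemeOver k).hom (bcSpec k k)) := inferInstance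
  let e : X ≅ GaloisDescent.bc k (Over.mk f) :=
    (asIso (pullback.fst (Over.mk f : SchemeOver k).hom (bcSpec k k))).symm
  have hρ' : IsBlowup (ρ ≫ e.hom) (I.comap e.inv) := hρ.comp_iso e
  have hI0' : I.comap e.inv ≠ ⊥ := by
    intro h
    apply hI0
    have : (I.comap e.inv).comap e.hom = I := by
      rw [← Scheme.IdealSheafData.comap_comp, e.hom_inv_id, Scheme.IdealSheafData.comap_id]
    rw [← this, h, Scheme.IdealSheafData.comap_bot]
  refine ⟨k, inferInstance, inferInstance, inferInstance, inferInstance, I.comap e.inv, Y,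
    ρ ≫ e.hom, hI0', hρ', hY, fun σ => ?_⟩
  -- `Gal(k/k)` is trivial
  have hσ : σ = 1 := AlgEquiv.ext fun x => by simpa using σ.commutes x
  rw [hσ, GaloisDescent.gal_one, Scheme.IdealSheafData.comap_id]
  exact hρ'

/-- **Crux `DescentAlgclosedToPerfect` from AUTOMORPHISM-invariant resolving ideals over
algebraically closed fields** (the restated antecedent γ1 of the crux notes, formalised). Suppose
that for every prime `p` at which resolution holds over all algebraically closed fields of
characteristic `p`, every reduced separated scheme `V` of finite type over an algebraically closed
field `K` of characteristic `p` carries a non-zero ideal sheaf `J` with REGULAR blow-up which is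
invariant under every scheme automorphism of `V` (`e⁻¹ J · 𝒪_V = J` for all `e : V ≅ V`, not
necessarily `K`-linear). Then `DescentAlgclosedToPerfect` holds: for `X` integral separated of finite
type over a perfect `k`, `V := X ×_k Spec k̄` is reduced separated of finite type over `k̄`, the
Galois automorphisms `gal σ` (`σ ∈ Aut(k̄/k)`) are scheme automorphisms of `V`, so `J` is
`Aut(k̄/k)`-invariant and descends with its blow-up
(`descentAlgclosedToPerfect_of_autInvariantResolvingIdeal`).
[cite: Kollar2007, 3.34.1–3.34.2 p. 131 and Thm. 3.36; BierstoneGrigorievMilmanWlodarczyk2011, Remark p. 23] -/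
theorem descentAlgclosedToPerfect_of_autInvariantResolvingIdealAlgClosed
    (H : ∀ p : ℕ, p.Prime →
      (∀ (k : Type) [Field k] [CharP k p] [IsAlgClosed k] (X : Scheme.{0})
        (f : X ⟶ Spec (.of k)), IsSeparated f → LocallyOfFiniteType f → QuasiCompact f →
        IsReduced X → Scheme.HasResolution X) →
      ∀ (K : Type) [Field K] [CharP K p] [IsAlgClosed K] (V : Scheme.{0}) (g : V ⟶ Spec (.of K)),
        IsSeparated g → LocallyOfFiniteType g → QuasiCompact g → IsReduced V →
        ∃ (J : V.IdealSheafData) (Y : Scheme.{0}) (ρ : Y ⟶ V),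
          J ≠ ⊥ ∧ (∀ e : V ≅ V, J.comap e.hom = J) ∧ IsBlowup ρ J ∧ Scheme.IsRegular Y) :
    Summit.ResolutionOfSingularities.ResolutionOfSingularities.Theses.AbhyankarShadows.DescentAlgclosedToPerfect := by
  refine descentAlgclosedToPerfect_of_autInvariantResolvingIdeal ?_
  intro p hp hA k _ _ _ X f hs hl hq hi
  haveI := hs
  haveI := hl
  haveI := hq
  let K : Type := AlgebraicClosure k
  haveI : CharP K p := charP_of_injective_algebraMap (algebraMap k K).injective p
  -- `V = X ×_k Spec k̄` is reduced (k perfect), separated and of finite type over `k̄`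
  haveI hXN : IsLocallyNoetherian X := LocallyOfFiniteType.isLocallyNoetherian f
  haveI : GeometricallyReduced (bcSpec k K) := geometricallyReduced_SpecMap_of_perfectField k K
  haveI : IsReduced (GaloisDescent.bc K (Over.mk f)) :=
    inferInstanceAs (IsReduced (pullback f (bcSpec k K)))
  have hsV : IsSeparated (pullback.snd (Over.mk f : SchemeOver k).hom (bcSpec k K)) :=
    inferInstanceAs (IsSeparated (pullback.snd f (bcSpec k K)))
  have hlV : LocallyOfFiniteType (pullback.snd (Over.mk f : SchemeOver k).hom (bcSpec k K)) :=
    inferInstanceAs (LocallyOfFiniteType (pullback.snd f (bcSpec k K)))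
  have hqV : QuasiCompact (pullback.snd (Over.mk f : SchemeOver k).hom (bcSpec k K)) :=
    inferInstanceAs (QuasiCompact (pullback.snd f (bcSpec k K)))
  obtain ⟨J, Y, ρ, hJ0, hJ, hρ, hY⟩ :=
    H p hp hA K (GaloisDescent.bc K (Over.mk f)) (pullback.snd _ _) hsV hlV hqV inferInstance
  refine ⟨J, Y, ρ, hJ0, fun σ => ?_, hρ, hY⟩
  -- the Galois automorphism `gal σ` as a scheme automorphism of `V`
  exact hJ ⟨GaloisDescent.gal K (Over.mk f) σ, GaloisDescent.gal K (Over.mk f) σ⁻¹,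
    GaloisDescent.gal_comp_gal_symm K (Over.mk f) σ, GaloisDescent.gal_symm_comp_gal K (Over.mk f) σ⟩

/-- The same for the item's canonical copy `Theses.Descent.DescentAlgclosedToPerfect`.
[cite: Kollar2007, Thm. 3.36] -/
theorem descentAlgclosedToPerfect_descent_of_autInvariantResolvingIdealAlgClosed
    (H : ∀ p : ℕ, p.Prime →
      (∀ (k : Type) [Field k] [CharP k p] [IsAlgClosed k] (X : Scheme.{0})
        (f : X ⟶ Spec (.of k)), IsSeparated f → LocallyOfFiniteType f → QuasiCompact f →
        IsReduced X → Scheme.HasResolution X) →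
      ∀ (K : Type) [Field K] [CharP K p] [IsAlgClosed K] (V : Scheme.{0}) (g : V ⟶ Spec (.of K)),
        IsSeparated g → LocallyOfFiniteType g → QuasiCompact g → IsReduced V →
        ∃ (J : V.IdealSheafData) (Y : Scheme.{0}) (ρ : Y ⟶ V),
          J ≠ ⊥ ∧ (∀ e : V ≅ V, J.comap e.hom = J) ∧ IsBlowup ρ J ∧ Scheme.IsRegular Y) :
    Summit.ResolutionOfSingularities.ResolutionOfSingularities.Theses.Descent.DescentAlgclosedToPerfect :=
  descentAlgclosedToPerfect_of_autInvariantResolvingIdealAlgClosed H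

end Summit.ResolutionOfSingularities.ResolutionOfSingularities.Theorems

end
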